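import Summits.BirchSwinnertonDyer.BirchSwinnertonDyer.Theorems.RamifiedHeegnerPairLeafPartnerRT
import Mathlib.NumberTheory.Padics.PadicNumbers
import HarnessLib

/-!
# Route `RamifiedHeegnerPair`, crux U₁ `LeafRankOneUpperAtThree` (stmt-BirchSwinnertonDyer-26022), line `partnerdescent` —
# partner kernel part 11: the Ribet–Takahashi degree drop EXACT AT `3` on a PAIR level from the FLAT cokernel property (G3♭)

HONEST FRAMING. Theorems only; helper file (`--supports stmt-BirchSwinnertonDyer-26022 --as helper`); no definition, no named fact, no
`sorry`; nothing booked, no item closed; CONDITIONAL on every displayed input; BSD is proved for no curve. Lead prover bsd-line-rhp-p2 g57,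
2026-08-30. PURPOSE: the partner road (ROAD-R1) consumes (G3) `PartnerCokernelThreeFree` (route item 27595, class-wide, RESEARCH on the
doubly-scalar locus). The lead's derivation (g56, pen-AGREED) gives the fifth property OFF the doubly-scalar locus for pair levels: this file
is the package + telescope for that FLAT form (G3♭), so that the road on orphan PAIRS with a non-scalar prime can run on (G3♭) — a statement
implied by the item (27595 ⇒ (G3♭) trivially) AND derivable from print (Ribet 1990 §4, Mazur/Helm multiplicity one, SGA7, Papikian–Rabinoff §3)
once those are typed. The V-side census of g57 (Cruxes/…/LEAD-G57-G3-LEDGER.md): every orphan pair with `N_V ≤ 55 555` is of this kind.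

* §1 `padicValNat_delta_empty_pair_of_cokernelUnit` — the telescope for ONE pair `S = {q, r}`: `ord_ℓ δ(∅) = ord_ℓ δ(S) + ord_ℓ c_q + ord_ℓ c_r`
  as soon as the ONE cokernel term `κ S r` is an `ℓ`-unit (`RTDegree.padicValNat_delta_empty_step` at `d = ∅`).
* §2 `ribetTakahashiPackageCokerThreeFlat_of_componentOrdersFiveFlat` — p776174's package theorem with the fifth property and the tenth
  conjunct relativised to «pair level, cokernel at `r`, `#V(ℚ_q)[3] ≠ 9`».
-/

noncomputable section

open scoped Classical

open WeierstrassCurve NumberField Literature.NumberTheory.EllipticCurves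
  Literature.NumberTheory.EllipticCurves.ModularForms Literature.NumberTheory.Automorphic
  Literature.NumberTheory.EllipticCurves.Rank1Residual
  Summit.BirchSwinnertonDyer.Rank1Residual Summit.BirchSwinnertonDyer.Rank1Residual.X11b

set_option linter.dupNamespace false
set_option autoImplicit false

namespace Summit.BirchSwinnertonDyer.BirchSwinnertonDyer.Theorems.LeafPartnerRTFlat

/-! ## §1 The telescope for one pair -/

section Telescope

open Finset

variable {ℓ : ℕ} [Fact ℓ.Prime]
  {Mult : Finset ℕ} {δ : Finset ℕ → ℕ} {cA ι κ : Finset ℕ → ℕ → ℕ} {c : ℕ → ℕ}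
  (h613 : ∀ ⦃d : Finset ℕ⦄, d ⊆ Mult → Even d.card → ∀ ⦃q r : ℕ⦄, q ∈ Mult → r ∈ Mult →
    q ∉ d → r ∉ d → q ≠ r →
    δ d * ι d q ^ 2 * κ (insert q (insert r d)) r ^ 2 =
      δ (insert q (insert r d)) * cA d q * cA (insert q (insert r d)) r)
  (hδ : ∀ D, 0 < δ D) (hcA : ∀ D q, 0 < cA D q)
  (hij : ∀ ⦃D : Finset ℕ⦄, D ⊆ Mult → ∀ ⦃q : ℕ⦄, q ∈ Mult → ι D q * κ D q = cA D q)
  (hvA : ∀ ⦃D : Finset ℕ⦄, D ⊆ Mult → ∀ ⦃q : ℕ⦄, q ∈ Mult →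
    padicValNat ℓ (cA D q) = padicValNat ℓ (c q))
  (hι : ∀ ⦃d : Finset ℕ⦄, d ⊆ Mult → ∀ ⦃q : ℕ⦄, q ∈ Mult → q ∉ d → padicValNat ℓ (ι d q) = 0)

include h613 hδ hcA hij hvA hι

/-- **(DEG) on a pair level from ONE cokernel unit.** For `q ≠ r` in `Mult`: if the cokernel term `κ {q, r} r` is an `ℓ`-unit then
`ord_ℓ δ(∅) = ord_ℓ δ({q, r}) + ord_ℓ c_q + ord_ℓ c_r` — the step `RTDegree.padicValNat_delta_empty_step` at `d = ∅` (Pasten §6.9, first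
pair; the cokernel of the step is read at `r` only). [cite: PastenShimura2024, §6.9 (EqSequentially) and Prop. 6.13]
[cite: PapikianRabinoff2016, Thm. 30] -/
theorem padicValNat_delta_empty_pair_of_cokernelUnit {q r : ℕ} (hq : q ∈ Mult) (hr : r ∈ Mult) (hqr : q ≠ r)
    (hκ : padicValNat ℓ (κ (insert q {r}) r) = 0) :
    padicValNat ℓ (δ ∅) = padicValNat ℓ (δ (insert q {r})) + padicValNat ℓ (c q) + padicValNat ℓ (c r) := by
  have h := RTDegree.padicValNat_delta_empty_step h613 hδ hcA hij hvA hι (Finset.empty_subset Mult) (by simp) hq hr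
    (Finset.notMem_empty q) (Finset.notMem_empty r) hqr (by simpa using hκ) (by simp)
  have hq' : q ∉ ({r} : Finset ℕ) := by simp [hqr]
  simp only [Finset.insert_empty] at h
  rw [Finset.sum_insert hq', Finset.sum_singleton] at h
  omega

end Telescope

/-! ## §2 The Pasten package WITH the flat fifth property (G3♭) -/

/-- **The receptacle-shaped Pasten package from the component-order functions WITH THE FLAT FIFTH PROPERTY (G3♭).** VERBATIM the
tree's `LeafPartnerRT.ribetTakahashiPackageCokerThree_of_componentOrdersFive` (p776174) with ONE hypothesis weakened and the tenth
conjunct weakened to match: the fifth property of `hG3` is asked only for a PAIR level `D = q·r` and only for the cokernel at `r`, and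
only when `V` does NOT have full `3`-torsion over `ℚ_q` (`#V(ℚ_q)[3] ≠ 9`, i.e. `ρ̄_{V,3}(Frob_q)` is not the scalar `1` — the lead's
non-scalar derivation LEAD-G56-G3-NONSCALAR.md, second-read AGREE by pen pss3 g26: Ribet's exact sequence + Helm 2007 Lemma 6.5 +
Papikian–Rabinoff Lemma 32); the exported (PG3♭) reads `¬ 3 ∣ κ {q, r} r` under the same conditions on the package curve. The other
nine conjuncts and their proofs are byte-for-byte those of p776174. CONDITIONAL on the displayed inputs; nothing booked; BSD is not proved.
-- adapted from Summits/BirchSwinnertonDyer/BirchSwinnertonDyer/Theorems/RamifiedHeegnerPairLeafPartnerRT.lean (fifth property and tenth conjunct relativised)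
[cite: PastenShimura2024, Prop. 6.13 and §6.6 (p. 23), Lemma 6.8 (p. 22), Lemma 6.14 (p. 23), Lemma 6.18 (p. 24)]
[cite: PapikianRabinoff2016, Thm. 30 and Lemma 32, Cor. 3.5] [cite: RibetTakahashi1997, Thm. 2] [cite: Helm2007, Def. 6.4, Lemma 6.5] -/
theorem ribetTakahashiPackageCokerThreeFlat_of_componentOrdersFiveFlat
    (hG3 : ∃ cI cJ : ComponentOrderFun,
      (∀ {D M : ℕ} {X : ShimuraCurveData D M} {W' : WeierstrassCurve ℚ}
          (P : ShimuraParametrizationData X W') (p : ℕ), 0 < cI P p ∧ 0 < cJ P p) ∧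
      ComponentOrders.ProductEq cI cJ ∧ ComponentOrders.Prop613 cI cJ ∧
      ComponentOrders.ImageEisenstein cI ∧ ComponentOrders.CokernelDvd cJ ∧
      (∀ {N D M : ℕ}, IsAdmissibleFactorization N D M →
        ∀ (X : ShimuraCurveData D M) (V : WeierstrassCurve ℚ) [V.IsElliptic] [V.IsGloballyMinimal],
          V.conductorNorm ℤ = N → ¬ 3 ∣ N → Irr V 3 →
        ∀ (q r : ℕ) [Fact q.Prime] [Fact r.Prime], q ≠ r → D = q * r →
          Nat.card (AddSubgroup.torsionBy ((V.baseChange ℚ_[q]).toAffine.Point) 3) ≠ 9 →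
        ∀ (V' : WeierstrassCurve ℚ) [V'.IsElliptic] (P : ShimuraParametrizationData X V'),
          P.IsMinimalFor V → ¬ 3 ∣ cJ P r))
    (h68 : PastenShimura2024_lemma_6_8_isogeny)
    (hJL : nonempty_shimuraParametrizationData)
    (W : WeierstrassCurve ℚ) [W.IsElliptic] [W.IsGloballyMinimal] (p : ℕ) [Fact p.Prime]
    (hirr : W.HasIrreducibleModPGaloisRep p)
    (N : ℕ) [NeZero N] (W₀ : WeierstrassCurve ℚ) [W₀.IsElliptic] [W₀.IsGloballyMinimal]
    (D₀ : ModularParametrizationData W₀ N)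
    (hN : W.conductorNorm ℤ = N) (hfW : IsNewformOf W D₀.f)
    (hmin : ∀ (W₂ : WeierstrassCurve ℚ) [W₂.IsElliptic] (D₂ : ModularParametrizationData W₂ N),
      D₂.f = D₀.f → D₀.modularDegree ≤ D₂.modularDegree) :
    ∃ (δ : Finset ℕ → ℕ) (cA ι κ : Finset ℕ → ℕ → ℕ),
      δ ∅ = D₀.modularDegree ∧
      (∀ D, 0 < δ D) ∧ (∀ D q, 0 < cA D q) ∧
      -- existential anchor: one class-minimal Shimura datum per admissible level realises `δ D`
      (∀ ⦃D : Finset ℕ⦄, D ⊆ (W.conductorNorm ℤ).primeFactors.filter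
            (fun q ↦ ∃ h : q.Prime, @WeierstrassCurve.HasMultiplicativeReductionAtPrime W q ⟨h⟩) →
          Even D.card →
        ∃ (X : ShimuraCurveData (∏ q ∈ D, q) (N / ∏ q ∈ D, q)) (W' : WeierstrassCurve ℚ)
          (_ : W'.IsElliptic) (P : ShimuraParametrizationData X W'), P.IsMinimalFor W ∧ P.deg = δ D) ∧
      -- (P613)
      (∀ ⦃d : Finset ℕ⦄, d ⊆ (W.conductorNorm ℤ).primeFactors.filter
            (fun q ↦ ∃ h : q.Prime, @WeierstrassCurve.HasMultiplicativeReductionAtPrime W q ⟨h⟩) →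
          Even d.card →
        ∀ ⦃q r : ℕ⦄,
          q ∈ (W.conductorNorm ℤ).primeFactors.filter
            (fun q ↦ ∃ h : q.Prime, @WeierstrassCurve.HasMultiplicativeReductionAtPrime W q ⟨h⟩) →
          r ∈ (W.conductorNorm ℤ).primeFactors.filter
            (fun q ↦ ∃ h : q.Prime, @WeierstrassCurve.HasMultiplicativeReductionAtPrime W q ⟨h⟩) →
          q ∉ d → r ∉ d → q ≠ r →
          δ d * ι d q ^ 2 * κ (insert q (insert r d)) r ^ 2 =
            δ (insert q (insert r d)) * cA d q * cA (insert q (insert r d)) r) ∧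
      -- (Pij)
      (∀ ⦃D : Finset ℕ⦄, D ⊆ (W.conductorNorm ℤ).primeFactors.filter
            (fun q ↦ ∃ h : q.Prime, @WeierstrassCurve.HasMultiplicativeReductionAtPrime W q ⟨h⟩) →
        ∀ ⦃q : ℕ⦄, q ∈ (W.conductorNorm ℤ).primeFactors.filter
            (fun q ↦ ∃ h : q.Prime, @WeierstrassCurve.HasMultiplicativeReductionAtPrime W q ⟨h⟩) →
          ι D q * κ D q = cA D q) ∧
      -- (P68)
      (∀ ⦃D : Finset ℕ⦄, D ⊆ (W.conductorNorm ℤ).primeFactors.filter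
            (fun q ↦ ∃ h : q.Prime, @WeierstrassCurve.HasMultiplicativeReductionAtPrime W q ⟨h⟩) →
        ∃ n : ℕ, 0 < n ∧ ¬ p ∣ n ∧
          ∀ q ∈ (W.conductorNorm ℤ).primeFactors.filter
              (fun q ↦ ∃ h : q.Prime, @WeierstrassCurve.HasMultiplicativeReductionAtPrime W q ⟨h⟩),
            cA D q ∣ n * padicValInt q W.minimalDiscriminantInt ∧
              padicValInt q W.minimalDiscriminantInt ∣ n * cA D q) ∧
      -- (PEis)
      (∀ ⦃d : Finset ℕ⦄, d ⊆ (W.conductorNorm ℤ).primeFactors.filter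
            (fun q ↦ ∃ h : q.Prime, @WeierstrassCurve.HasMultiplicativeReductionAtPrime W q ⟨h⟩) →
        ∀ ⦃q : ℕ⦄, q ∈ (W.conductorNorm ℤ).primeFactors.filter
            (fun q ↦ ∃ h : q.Prime, @WeierstrassCurve.HasMultiplicativeReductionAtPrime W q ⟨h⟩) →
          q ∉ d → ∀ r : ℕ, r.Prime → ¬ r ∣ W.conductorNorm ℤ →
            (ι d q : ℤ) ∣ (r : ℤ) + 1 - W.LFunction r) ∧
      -- (P618) Pasten Lemma 6.18 (Papikian–Rabinoff), FULL
      (∀ ⦃D : Finset ℕ⦄, D ⊆ (W.conductorNorm ℤ).primeFactors.filter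
            (fun q ↦ ∃ h : q.Prime, @WeierstrassCurve.HasMultiplicativeReductionAtPrime W q ⟨h⟩) →
          Even D.card → ∀ ⦃q : ℕ⦄, q ∈ D → (q ≠ 2 → κ D q ∣ q - 1) ∧ (q = 2 → κ D q ∣ 2)) ∧
      -- (PG3♭) the cokernel at `r` of the PAIR level `{q, r}` is `3`-free when `3 ∤ N`, `W[3]` is irreducible and `W` does NOT have
      -- full `3`-torsion over `ℚ_q` (i.e. `ρ̄_{W,3}(Frob_q)` is not the scalar `1`)
      (¬ 3 ∣ N → Irr W 3 →
        ∀ ⦃q r : ℕ⦄ [Fact q.Prime] [Fact r.Prime],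
          q ∈ (W.conductorNorm ℤ).primeFactors.filter
            (fun q ↦ ∃ h : q.Prime, @WeierstrassCurve.HasMultiplicativeReductionAtPrime W q ⟨h⟩) →
          r ∈ (W.conductorNorm ℤ).primeFactors.filter
            (fun q ↦ ∃ h : q.Prime, @WeierstrassCurve.HasMultiplicativeReductionAtPrime W q ⟨h⟩) →
          q ≠ r → Nat.card (AddSubgroup.torsionBy ((W.baseChange ℚ_[q]).toAffine.Point) 3) ≠ 9 →
          ¬ 3 ∣ κ (insert q {r}) r) := by
  have hp : p.Prime := Fact.out
  obtain ⟨cI, cJ, hpos, hProd, h613, hEis, hCok, hfive⟩ := hG3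
  -- the multiplicative primes: `q ∥ N`
  set Mlt : Finset ℕ := (W.conductorNorm ℤ).primeFactors.filter
    (fun q ↦ ∃ h : q.Prime, @WeierstrassCurve.HasMultiplicativeReductionAtPrime W q ⟨h⟩) with hMlt
  have hMlt_exact : ∀ q ∈ Mlt, q.Prime ∧ q ∣ N ∧ ¬ q ^ 2 ∣ N := by
    intro q hq
    obtain ⟨hqN, hqp, hm⟩ := Finset.mem_filter.mp hq
    haveI : Fact q.Prime := ⟨hqp⟩
    refine ⟨hqp, hN ▸ (Nat.mem_primeFactors.mp hqN).2.1, hN ▸ not_sq_dvd_conductorNorm_of_mult W q hm⟩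
  have hMlt_cpos : ∀ q ∈ Mlt, 0 < padicValInt q W.minimalDiscriminantInt := by
    intro q hq
    obtain ⟨-, hqp, hm⟩ := Finset.mem_filter.mp hq
    haveI : Fact q.Prime := ⟨hqp⟩
    exact padicValInt_minimalDiscriminantInt_pos_of_mult W q hm
  -- admissible levels and the chosen class-minimal data (Jacquet–Langlands)
  have hNpos : 0 < N := Nat.pos_of_ne_zero (NeZero.ne N)
  have hadm : ∀ D : Finset ℕ, D ⊆ Mlt ∧ Even D.card →
      IsAdmissibleFactorization N (∏ q ∈ D, q) (N / ∏ q ∈ D, q) :=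
    fun D h ↦ isAdmissibleFactorization_prod_of_even hNpos (fun ℓ hℓ ↦ hMlt_exact ℓ (h.1 hℓ)) h.2
  have hex : ∀ D : Finset ℕ, D ⊆ Mlt ∧ Even D.card →
      ∃ (X : ShimuraCurveData (∏ q ∈ D, q) (N / ∏ q ∈ D, q)) (W' : WeierstrassCurve ℚ)
        (_ : W'.IsElliptic) (P : ShimuraParametrizationData X W'), P.IsMinimalFor W := by
    intro D h
    obtain ⟨X⟩ := nonempty_shimuraCurveData_holds (hadm D h)
    obtain ⟨W', hW', P, hP⟩ :=
      ShimuraParametrizationData.exists_isMinimalFor_of_nonempty (hJL (hadm D h) X W hN)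
    exact ⟨X, W', hW', P, hP⟩
  choose X W' hW'e P hPmin using hex
  -- the `D = 1` bridge at the empty level: `δ^{Sh}_{1,N} = δ_{1,N}`
  have hbridge : ∀ {Dn Mn : ℕ} (_ : Dn = 1) (_ : Mn = N) {Xe : ShimuraCurveData Dn Mn}
      {We : WeierstrassCurve ℚ} [We.IsElliptic] {Pe : ShimuraParametrizationData Xe We},
      Pe.IsMinimalFor W → Pe.deg = D₀.modularDegree := by
    intro Dn Mn hD hM Xe We _ Pe hPe
    subst hD; subst hM
    exact hPe.deg_eq_modularDegree D₀ hfW hmin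
  -- the four functions
  refine ⟨fun D ↦ if h : D ⊆ Mlt ∧ Even D.card then (P D h).deg else D₀.modularDegree,
    fun D q ↦ if h : D ⊆ Mlt ∧ Even D.card then
        (if q ∈ Mlt then ((W' D h).minimalDiscriminantNorm ℤ).factorization q else 1)
      else (if q ∈ Mlt then padicValInt q W.minimalDiscriminantInt else 1),
    fun D q ↦ if h : D ⊆ Mlt ∧ Even D.card then cI (P D h) q else 1,
    fun D q ↦ if h : D ⊆ Mlt ∧ Even D.card then cJ (P D h) q
      else (if q ∈ Mlt then padicValInt q W.minimalDiscriminantInt else 1),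
    ?_, ?_, ?_, ?_, ?_, ?_, ?_, ?_, ?_, ?_⟩
  · have h0 : (∅ : Finset ℕ) ⊆ Mlt ∧ Even (∅ : Finset ℕ).card := ⟨Finset.empty_subset _, by simp⟩
    simp only [dif_pos h0]
    haveI := hW'e ∅ h0
    exact hbridge Finset.prod_empty (by rw [Finset.prod_empty, Nat.div_one]) (hPmin ∅ h0)
  · intro D
    by_cases h : D ⊆ Mlt ∧ Even D.card
    · simp only [dif_pos h]; exact (P D h).deg_pos
    · simp only [dif_neg h]; exact D₀.deg_pos
  · intro D q
    by_cases h : D ⊆ Mlt ∧ Even D.card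
    · by_cases hq : q ∈ Mlt
      · simp only [dif_pos h, if_pos hq]
        haveI := hW'e D h
        obtain ⟨hqp, hqN, hq2⟩ := hMlt_exact q hq
        have := hProd (hadm D h) (X D h) W hN (W' D h) (P D h) (hPmin D h) q hqp hqN hq2
        rw [← this]
        exact Nat.mul_pos (hpos (P D h) q).1 (hpos (P D h) q).2
      · simp only [dif_pos h, if_neg hq]; exact one_pos
    · by_cases hq : q ∈ Mlt
      · simp only [dif_neg h, if_pos hq]; exact hMlt_cpos q hq
      · simp only [dif_neg h, if_neg hq]; exact one_pos
  · intro D hD hDe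
    have h : D ⊆ Mlt ∧ Even D.card := ⟨hD, hDe⟩
    refine ⟨X D h, W' D h, hW'e D h, P D h, hPmin D h, ?_⟩
    simp only [dif_pos h]
  ---------------------------------------------------------------- (P613)
  · intro d hd hde q r hq hr hqd hrd hqr
    have hq' : q ∉ insert r d := by simp [hqr, hqd]
    set D' : Finset ℕ := insert q (insert r d) with hD'
    have hdA : d ⊆ Mlt ∧ Even d.card := ⟨hd, hde⟩
    have hD'A : D' ⊆ Mlt ∧ Even D'.card := by
      refine ⟨?_, ?_⟩
      · intro x hx
        rcases Finset.mem_insert.mp hx with rfl | hx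
        · exact hq
        rcases Finset.mem_insert.mp hx with rfl | hx
        · exact hr
        · exact hd hx
      · rw [hD', Finset.card_insert_of_notMem hq', Finset.card_insert_of_notMem hrd]
        obtain ⟨k, hk⟩ := hde
        exact ⟨k + 1, by omega⟩
    obtain ⟨hqp, -, -⟩ := hMlt_exact q hq
    obtain ⟨hrp, -, -⟩ := hMlt_exact r hr
    haveI := hW'e d hdA
    haveI := hW'e D' hD'A
    -- the level arithmetic: `∏D' = (∏d)·(q·r)` and `N/∏d = q·r·(N/∏D')`
    have hprod : ∏ x ∈ D', x = (∏ x ∈ d, x) * (q * r) := by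
      rw [hD', Finset.prod_insert hq', Finset.prod_insert hrd]; ring
    have hadmD' := hadm D' hD'A
    have hdivD' : (∏ x ∈ D', x) * (N / ∏ x ∈ D', x) = N := hadmD'.mul_eq
    have hdpos : 0 < ∏ x ∈ d, x := Finset.prod_pos fun x hx ↦ (hMlt_exact x (hd hx)).1.pos
    have hlevel : N / ∏ x ∈ d, x = q * r * (N / ∏ x ∈ D', x) := by
      have : N = (∏ x ∈ d, x) * (q * r * (N / ∏ x ∈ D', x)) := by
        rw [← mul_assoc, ← hprod]; exact hdivD'.symm
      conv_lhs => rw [this]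
      rw [Nat.mul_div_cancel_left _ hdpos]
    have key := h613 hqp hrp hqr hprod hlevel hadmD' (X d hdA) (X D' hD'A) W hN (W' d hdA) (P d hdA)
      (hPmin d hdA) (W' D' hD'A) (P D' hD'A) (hPmin D' hD'A)
    -- unfold the four functions at the admissible levels `d`, `D'`
    simp only [dif_pos hdA, dif_pos hD'A, if_pos hq, if_pos hr]
    calc (P d hdA).deg * cI (P d hdA) q ^ 2 * cJ (P D' hD'A) r ^ 2
        = (P d hdA).deg * (cI (P d hdA) q ^ 2 * cJ (P D' hD'A) r ^ 2) := by ring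
      _ = (P D' hD'A).deg * (((W' d hdA).minimalDiscriminantNorm ℤ).factorization q *
            ((W' D' hD'A).minimalDiscriminantNorm ℤ).factorization r) := key
      _ = _ := by ring
  ---------------------------------------------------------------- (Pij)
  · intro D hD q hq
    by_cases h : D ⊆ Mlt ∧ Even D.card
    · haveI := hW'e D h
      obtain ⟨hqp, hqN, hq2⟩ := hMlt_exact q hq
      simp only [dif_pos h, if_pos hq]
      exact hProd (hadm D h) (X D h) W hN (W' D h) (P D h) (hPmin D h) q hqp hqN hq2
    · simp only [dif_neg h, if_pos hq, one_mul]
  ---------------------------------------------------------------- (P68)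
  · intro D hD
    by_cases h : D ⊆ Mlt ∧ Even D.card
    · haveI := hW'e D h
      -- an isogeny `W → A_D` of degree prime to `p` (`E[p]` irreducible)
      have hp0 : (p : ℚ) ≠ 0 := by exact_mod_cast hp.ne_zero
      obtain ⟨lam, hlam⟩ :=
        Literature.NumberTheory.EllipticCurves.SkinnerUrban2014.exists_isogeny_not_dvd_degree_of_irreducible
          hp0 hirr (hPmin D h).1
      refine ⟨lam.degree, lam.degree_pos, hlam, fun q hq ↦ ?_⟩
      obtain ⟨hqp, hqN, hq2⟩ := hMlt_exact q hq
      obtain ⟨a, b, ha, hb, haD, hbD, hEq⟩ := h68 W (W' D h) lam q hqp (hN ▸ hqN) (hN ▸ hq2)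
      simp only [dif_pos h, if_pos hq]
      rw [padicValInt_minimalDiscriminantInt_eq_factorization W hqp]
      set cW := (W.minimalDiscriminantNorm ℤ).factorization q
      set cW' := ((W' D h).minimalDiscriminantNorm ℤ).factorization q
      -- `cW · b = a · cW'` with `a, b ∣ deg λ`
      refine ⟨?_, ?_⟩
      · -- `cW' ∣ deg λ · cW`
        have h1 : cW' ∣ cW * b := ⟨a, by rw [hEq]; ring⟩
        exact h1.trans (by rw [mul_comm]; exact Nat.mul_dvd_mul_right hbD cW)
      · -- `cW ∣ deg λ · cW'`
        have h1 : cW ∣ a * cW' := ⟨b, by rw [← hEq]⟩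
        exact h1.trans (Nat.mul_dvd_mul_right haD cW')
    · refine ⟨1, one_pos, hp.one_lt.ne' ∘ (Nat.dvd_one.mp ·), fun q hq ↦ ?_⟩
      simp only [dif_neg h, if_pos hq, one_mul, dvd_refl, and_self]
  ---------------------------------------------------------------- (PEis)
  · intro d hd q hq hqd r' hr' hr'N
    by_cases h : d ⊆ Mlt ∧ Even d.card
    · haveI := hW'e d h
      obtain ⟨hqp, hqN, hq2⟩ := hMlt_exact q hq
      have hadmd := hadm d h
      -- `q ∥ N/∏d`: `q` is a multiplicative prime outside `d`
      have hqprod : ¬ q ∣ ∏ x ∈ d, x := by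
        intro hdiv
        obtain ⟨x, hx, hqx⟩ := (Prime.dvd_finsetProd_iff hqp.prime _).mp hdiv
        have : q = x := (Nat.prime_dvd_prime_iff_eq hqp (hMlt_exact x (hd hx)).1).mp hqx
        exact hqd (this ▸ hx)
      have hqM : q ∣ N / ∏ x ∈ d, x := by
        have : q ∣ (∏ x ∈ d, x) * (N / ∏ x ∈ d, x) := by rw [hadmd.mul_eq]; exact hqN
        exact ((Nat.Prime.dvd_mul hqp).mp this).resolve_left hqprod
      have hq2M : ¬ q ^ 2 ∣ N / ∏ x ∈ d, x := fun h2 ↦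
        hq2 (h2.trans (Nat.div_dvd_of_dvd (Dvd.intro _ hadmd.mul_eq)))
      have key := hEis hadmd (X d h) W hN (W' d h) (P d h) (hPmin d h) q hqp hqM hq2M r' hr'
        (hN ▸ hr'N)
      simp only [dif_pos h]
      rw [LFunction_eq_of_isIsogenous_holds W (W' d h) (hPmin d h).1]
      exact_mod_cast key
    · simp only [dif_neg h, Nat.cast_one, one_dvd]
  ---------------------------------------------------------------- (P618)
  · intro D hD hDe q hqD
    have h : D ⊆ Mlt ∧ Even D.card := ⟨hD, hDe⟩
    haveI := hW'e D h
    obtain ⟨hqp, -, -⟩ := hMlt_exact q (hD hqD)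
    have hqdvd : q ∣ ∏ x ∈ D, x := Finset.dvd_prod_of_mem _ hqD
    simp only [dif_pos h]
    exact hCok (hadm D h) (X D h) W hN (W' D h) (P D h) (hPmin D h) q hqp hqdvd
  ---------------------------------------------------------------- (PG3♭)
  · intro h3N hirr3 q r _ _ hq hr hqr hns
    have hq' : q ∉ ({r} : Finset ℕ) := by simp [hqr]
    have h : insert q ({r} : Finset ℕ) ⊆ Mlt ∧ Even (insert q ({r} : Finset ℕ)).card := by
      refine ⟨?_, ?_⟩
      · intro x hx
        rcases Finset.mem_insert.mp hx with rfl | hx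
        · exact hq
        · rw [Finset.mem_singleton] at hx; exact hx ▸ hr
      · rw [Finset.card_insert_of_notMem hq', Finset.card_singleton]; exact ⟨1, rfl⟩
    haveI := hW'e _ h
    have hprod : ∏ x ∈ insert q ({r} : Finset ℕ), x = q * r := by
      rw [Finset.prod_insert hq', Finset.prod_singleton]
    simp only [dif_pos h]
    exact hfive (hadm _ h) (X _ h) W hN h3N hirr3 q r hqr hprod hns (W' _ h) (P _ h) (hPmin _ h)

end Summit.BirchSwinnertonDyer.BirchSwinnertonDyer.Theorems.LeafPartnerRTFlat

end
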